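import Summits.ResolutionOfSingularities.ResolutionOfSingularities.Theorems.UniversalCellsCampaignW82PinnedTowerClimb
import Summits.ResolutionOfSingularities.ResolutionOfSingularities.Theorems.UniversalCellsCampaignW82PrimeFieldTransferLinks
import Summits.ResolutionOfSingularities.ResolutionOfSingularities.Theorems.UniversalCellsCampaignW82FamilyTransferGraded
import HarnessLib

/-!
# [OURS · L1 W8.2] Links: crux `PrimeFieldToPerfect` (stmt-15233) from the perfection step AT THE RATIONAL TOWER ONLY

Cell `res-hironaka` (run/shared/lean/pub/res-hironaka/), LADDER-RESOLUTION rung L (RESCUE), slot W8.2; host route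
`UniversalCells`, host item `PrimeFieldToPerfect` (stmt-ResolutionOfSingularities-15233), door 1. By-name leaf
(imports the Theses cone through `…PrimeFieldTransferLinks`), written by res-L1-s82-pv-1 (gen 4), for
`…PinnedTower.lean` / `…PinnedTowerClimb.lean`.

* `primeFieldTransferAt_of_rationalTower` — the `p`-slice `PrimeFieldTransferAt p` of the crux from resolution over
  the rational tower `(𝔽_p(t_i : i ∈ ι))^{perf}`, `ι` finite non-empty;
* **`primeFieldTransferAt_of_perfectionStepAt_rationalTower`** — the `p`-slice from the PERFECTION STEP AT THE
  RATIONAL TOWER: `PerfectionStepAt M ⊤` for every perfect `M` purely inseparable over `Frac 𝔽_p[t_i : i ∈ ι]`,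
  `ι` finite; **`primeFieldToPerfect_of_forall_perfectionStepAt_rationalTower`** — the crux itself from this at
  every prime. This SHARPENS the door-1 I-candidate `primeFieldToPerfect_of_forall_perfectionStepDimLe_top`
  (p475515: the step at EVERY perfect `M`) to the countably many countable tower fields
  (`perfectionStepAt_rationalTower_of_perfectionStepDimLe_top`: the old hypothesis implies the new one).

HONEST FRAMING. OURS theorems about OURS statements (role replaced: §17 ¶2 p.89 l.59–62 of [Hironaka2017], typed AS
PRINTED as `S17Methodology.U89_3`); NOT statements of the manuscript; nothing attributed to its author; no typed
candidate used. Pure logic over landed theorems; the residual stays open from dimension `4`. AI work, weaker than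
expert review; no claim beyond the kernel.
-/

noncomputable section

set_option linter.dupNamespace false -- mandated namespace of this single-conjunct summit

open CategoryTheory CategoryTheory.Limits AlgebraicGeometry TopologicalSpace
open Literature.AlgebraicGeometry.Resolution

namespace Summit.ResolutionOfSingularities.ResolutionOfSingularities.Theorems.CampaignW82

/-- **The `p`-slice of crux stmt-15233 from resolution over the rational tower** (`ι` finite non-empty;
`…PinnedTower.reducedRes_of_primeField_of_rationalTower`). [folklore] -/
theorem primeFieldTransferAt_of_rationalTower (p : ℕ) [hp : Fact p.Prime]
    (htower : ∀ (ι : Type) [Finite ι] [Nonempty ι] (M : Type) [Field M] [PerfectField M]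
      [Algebra (FractionRing (MvPolynomial ι (ZMod p))) M]
      [IsPurelyInseparable (FractionRing (MvPolynomial ι (ZMod p))) M],
      ∀ (X : Scheme.{0}) (f : X ⟶ Spec (.of M)), IsSeparated f → LocallyOfFiniteType f →
        QuasiCompact f → IsIntegral X → Scheme.HasResolution X) :
    PrimeFieldTransferAt p :=
  fun h₀ k _ _ _ X f hs hl hq hr => reducedRes_of_primeField_of_rationalTower p hp.out h₀ htower k X f hs hl hq hr

/-- **The `p`-slice of crux stmt-15233 from the PERFECTION STEP AT THE RATIONAL TOWER** (`PerfectionStepAt M ⊤`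
for every perfect `M` purely inseparable over `Frac 𝔽_p[t_i : i ∈ ι]`, every finite `ι`;
`…PinnedTowerClimb.reducedRes_of_primeField_of_perfectionStepAt_tower`). [folklore] -/
theorem primeFieldTransferAt_of_perfectionStepAt_rationalTower (p : ℕ) [hp : Fact p.Prime]
    (hstep : ∀ (ι : Type) [Finite ι] (M : Type) [Field M] [PerfectField M]
      [Algebra (FractionRing (MvPolynomial ι (ZMod p))) M]
      [IsPurelyInseparable (FractionRing (MvPolynomial ι (ZMod p))) M], PerfectionStepAt M ⊤) :
    PrimeFieldTransferAt p :=
  fun h₀ k _ _ _ X f hs hl hq hr =>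
    reducedRes_of_primeField_of_perfectionStepAt_tower p hp.out h₀ hstep k X f hs hl hq hr

/-- **DOOR 1 OF SLOT W8.2 FROM THE RESIDUAL AT THE RATIONAL TOWER**: the crux
`Theses.UniversalCells.PrimeFieldToPerfect` (stmt-ResolutionOfSingularities-15233) follows from the perfection step
`PerfectionStepAt M ⊤` at the perfect closures `M` of the purely transcendental fields `𝔽_p(t_i : i ∈ ι)` (`ι`
finite), for every prime `p` — countably many countable fields per prime, instead of all perfect fields
(`primeFieldToPerfect_of_forall_perfectionStepDimLe_top`). [folklore] -/
theorem primeFieldToPerfect_of_forall_perfectionStepAt_rationalTower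
    (hstep : ∀ (p : ℕ), p.Prime → ∀ (ι : Type) [Finite ι] (M : Type) [Field M] [PerfectField M]
      [Algebra (FractionRing (MvPolynomial ι (ZMod p))) M]
      [IsPurelyInseparable (FractionRing (MvPolynomial ι (ZMod p))) M], PerfectionStepAt M ⊤) :
    Summit.ResolutionOfSingularities.ResolutionOfSingularities.Theses.UniversalCells.PrimeFieldToPerfect :=
  primeFieldToPerfect_iff.2 fun p hp =>
    haveI : Fact p.Prime := ⟨hp⟩
    primeFieldTransferAt_of_perfectionStepAt_rationalTower p (hstep p hp)

/-- **The old I-candidate implies the new one**: `PerfectionStepDimLe p ⊤` (the step at every perfect field of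
characteristic `p`) gives the step at the rational tower (tower fields have characteristic `p`). [folklore] -/
theorem perfectionStepAt_rationalTower_of_perfectionStepDimLe_top (p : ℕ) [hp : Fact p.Prime]
    (h : PerfectionStepDimLe p ⊤) (ι : Type) [Finite ι] (M : Type) [Field M] [PerfectField M]
    [Algebra (FractionRing (MvPolynomial ι (ZMod p))) M]
    [IsPurelyInseparable (FractionRing (MvPolynomial ι (ZMod p))) M] : PerfectionStepAt M ⊤ := by
  haveI : CharP (FractionRing (MvPolynomial ι (ZMod p))) p :=
    charP_of_injective_algebraMap (IsFractionRing.injective (MvPolynomial ι (ZMod p)) _) p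
  haveI : CharP M p :=
    charP_of_injective_algebraMap (algebraMap (FractionRing (MvPolynomial ι (ZMod p))) M).injective p
  exact (perfectionStepDimLe_iff_forall p ⊤).1 h M

end Summit.ResolutionOfSingularities.ResolutionOfSingularities.Theorems.CampaignW82

end
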